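import Mathlib.Algebra.GroupWithZero.Subgroup
import Mathlib.Topology.Algebra.Valued.NormedValued
import Literature.IUT.LogThetaLattice.TensorPacketsRingStructuresProofs
import Literature.IUT.LogThetaLattice.HolomorphicLogShellsProofs
import Literature.IUT.LogVolume.TensorPacketRing
import HarnessLib

/-!
# Bridge: the log-shell / tensor-packet interface of [IUTchIII] Prop 3.1–3.2 (abc-iut-L6-t4,
# `TensorPackets.lean`) INSTANTIATED at the local model of [IUTchIII] Rmk 1.2.2 (i) / Rmk 3.1.1 (i)
# (abc-iut-L6-t3 `LocalLogShells` / `HolomorphicLogShells`, abc-iut-L4-t3 `LogShells`, abc-iut-S1 `LocalUnitLog`)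

MERGE-MAP (plan/L6/MERGE-MAP.md) §1, row «LogThetaLattice.TensorPackets · header TODO-merge t3 (Def 1.1,
Prop 1.2 log-shells) … log-shell identification: BRIDGE now possible» — row 53, GO abc-iut-L6-lead §F v1.11
(seat abc-iut-w4-d019). S. Mochizuki, *Inter-universal Teichmüller theory III*, kurims manuscript (May
2020) [cite: Mochizuki2012, III Prop 3.1 p.92; Prop 3.2 pp.97–99; Rmk 3.1.1 (i) pp.93–94; Rmk 1.2.2 (i) p.36].
Claim key DISPUTED (D-0012); the objects below are classical local-field objects and this file takes no
side on anything; nothing here bears on [IUTchIII] Cor 3.12.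

WHAT IS BRIDGED. abc-iut-L6-t4's `TensorPackets.lean` types [IUTchIII] Prop 3.1/3.2 over FAMILIES OF TYPES
indexed by the capsule index set `A` and the finite set `Vfib` of `v ∈ 𝕍` over the fixed `v_ℚ`:
`L α v` (the ind-topological field `log(^α𝓕_v)`, a commutative `𝕜`-algebra), `O α v : Subring (L α v)` (the
integral structure `Ψ_{log(^α𝓕_v)} ∪ {0} ≅ 𝒪`), `D α v` (the module `log(^α𝒟^⊢_v)`), `I α v : AddSubgroup (D α v)`
(the mono-analytic log-shell `𝓘_{^α𝒟^⊢_v}`), and families `e α v : D α v ≃ₗ[𝕜] L α v` (Prop 3.2 (i)), with the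
header note "TODO-merge: abc-iut-L6-t3 (Def. 1.1, Prop. 1.2 of [IUTchIII])". Print fixes these at the
local model (Rmk 1.2.2 (i) p. 36: "`k := K_v` an MLF, … the log-shell `I_{†𝓕_v}` corresponds to the submodule
`I_k := (p_v^*)⁻¹ · log_k(𝒪_k^×) ⊆ k` … the evident inclusions `𝒪_k^▷ ⊆ 𝒪_k ⊆ I_k`"; Rmk 3.1.1 (i) p. 93:
"`log(^α𝓕_v)` … `Ψ_{log(^α𝓕_v)}` is a copy of … `𝒪 ⊆ k̄`"; Rmk 3.1.1 (ii) p. 95: "the tensor product of the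
`{K_{v_α}}_{α∈A}`"). THIS FILE supplies that model — at the finite level `K_v` of the ind-object, the
level at which the log-shell itself lives (it is `G_v`-invariant) and at which abc-iut-L6-t4's corrected
finite-level statements (`Prop31i_ringStructures''`, `TensorPacketsRingStructures.lean`) are stated:

* `holField K : A → Vfib → Type := fun _ v => K v` — t4's `L`, copies of `K_v` labelled by `α ∈ A`;
  `monoModule K` — t4's `D`, the same underlying `ℚ_p`-module (Prop 1.2 (vi)–(vii): `log(†𝒟^⊢_v)` "may be
  naturally identified" with `log(†𝓕_v)`); `compat` — t4's `e`, the identity (Prop 3.2 (i) at the model);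
* `integralStructure K v : Subring (K v)` — t4's `O`: `𝒪_{K_v} = {‖x‖ ≤ 1}` (Mathlib
  `NormedField.valuation.integer`);
* `logShellAddSubgroup p K v : AddSubgroup (K v)` — t4's `I`: the log-shell `I_k = (p*)⁻¹ · log_p(𝒪_k^×)` as an
  ADDITIVE SUBGROUP, built from abc-iut-S1's `LogVolume.logUnitsAddSubgroup p K` ([IUTchIV] Prop 1.2's
  `log_p(R^×)`) scaled by `(p*)⁻¹`.

What is PROVED (identifications by FQN; nothing of L6-t3 / L6-t4 / L4-t3 / S1 is restated):
* `coe_logShellAddSubgroup` — AS A SET t4's `I` IS abc-iut-L4-t3's log-shell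
  `AbsoluteAnabelian.logShell (PadicLogOnUnits.ofUnitLog p K)` (the object abc-iut-L6-t3's
  `HolomorphicLogShells.lean` is written over; abc-iut-L3-t11 `logShell_ofUnitLog`), and
  `coe_logShellAddSubgroup_eq_nonarchLogShell` — it IS abc-iut-L6-t3's `nonarchLogShell O logk p`
  (`LocalLogShells.lean`, Rmk 1.2.2 (i)) for any valuation ring / logarithm data matching the model
  (abc-iut-L3-t11 `nonarchLogShell_eq_image_logUnits`);
* `integralStructure_subset_logShell` (Prop 1.2 (v) (b^non) / Rmk 1.2.2 (i) "`𝒪_k ⊆ I_k`"),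
  `isCompact_logShellAddSubgroup`, `isOpen_logShellAddSubgroup` (Prop 1.2 (v) (a^non) "compact, hence of
  finite log-volume" — `HolomorphicLogShellsProofs.isCompact/isOpen_logShell_ofUnitLog`, abc-iut-S1 underneath);
* t4's named statements AT THE MODEL: `prop31ii_integralStructures_model` (Prop 3.1 (ii), via t4/t5
  `Prop31ii_integralStructures_of_isField`) and `prop31i_ringStructures''_model` (Prop 3.1 (i), finite
  level, via abc-iut-L6-t5 `Prop31i_ringStructures''_holds`, for `K_v/ℚ_p` finite);
* packets: `mem_shellPacket1_model_iff` / `coe_shellPacket1_model` (Prop 3.2 (ii) first display: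
  `𝓘(^α𝒟^⊢_{v_ℚ}) = ⊕_v 𝓘_v` is the product of the local shells), `isCompact_shellPacket1_model`,
  `isOpen_shellPacket1_model`; `shellPacketN_transport_model` (Prop 3.2 (ii) last sentence: transporting
  along the model compatibility isomorphism changes nothing);
* **`packetSummand_eq_packetAlgebra`** — t4's direct SUMMANDS `PacketSummand 𝕜 L v⃗ = ⊗_α K_{v_α}` of
  Prop 3.1's `⊗_α ⊕_v = ⊕_{v⃗} ⊗_α` (Rmk 3.1.1 (ii)) ARE abc-iut-S1's [IUTchIV] Prop 1.1/1.2 packet algebras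
  `LogVolume.PacketAlgebra p (K ∘ v⃗)` (definitionally), and `packetDecomposition_tprod_shell_mem` — on a
  pure tensor of shell elements the `v⃗`-component of t4's `packetDecomposition` lies in
  `((p*)⁻¹)^{|A|} • LogVolume.logPacket p (K ∘ v⃗)`: the exact scaling between [IUTchIII]'s `𝓘`-packets and
  [IUTchIV]'s `log_p(R_I^×) = ⊗ log_p(R_i^×)` (so that the [IUTchIV] §1 estimates typed by abc-iut-S1 apply
  summand-wise to t4's packets).
NOT here (honest residue): the ind-level objects `log(^α𝓕_v) ≅ k̄_v` (direct limit over finite `K'/K_v`)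
and the `^αΠ_v`-actions — t4's file does not model ind-topologies either; the archimedean `v_ℚ` (t4's
`ArchimedeanShellData`, inhabited by `TensorPacketsHermitian.lean`).
-/

noncomputable section

namespace Literature.IUT.LogThetaLattice

namespace LogShellBridge

open Set Metric
open scoped Pointwise TensorProduct
open Literature.IUT.LogVolume Literature.AnabelianGeometry.AbsoluteAnabelian PiTensorProduct

/-! ### 1. The model parameters of abc-iut-L6-t4's interface -/

/-- **IUTchIII:Rmk3.1.1(i)** (kurims p.93) at the finite level `K_v`: `log(^α𝓕_v)` for `α ∈ A`, `v ∈ Vfib`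
— t4's parameter `L α v` — a copy of the local field `K_v` labelled by `α` ("each `log(^α𝓕_v)` is
isomorphic to `k̄`"; finite stage `K_v` of the ind-object). [claim: Mochizuki2012, status: disputed] -/
abbrev holField (A : Type) {Vfib : Type} (K : Vfib → Type) : A → Vfib → Type := fun _ v => K v

/-- **IUTchIII:Prop1.2(vi)** (kurims p.33) at the model: `log(^α𝒟^⊢_v)` — t4's parameter `D α v` — the
underlying `ℚ_{v_ℚ}`-module of `K_v` (no ring structure retained in the mono-analytic setting).
[claim: Mochizuki2012, status: disputed] -/
abbrev monoModule (A : Type) {Vfib : Type} (K : Vfib → Type) : A → Vfib → Type := fun _ v => K v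

variable (p : ℕ) [hp : Fact p.Prime]
variable {A : Type} {Vfib : Type}
variable (K : Vfib → Type) [∀ v, NontriviallyNormedField (K v)] [∀ v, NormedAlgebra ℚ_[p] (K v)]

/-- **IUTchIII:Rmk3.1.1(i)** (kurims p.93) / Rmk 1.2.2 (i) p.36: the integral structure
`Ψ_{log(^α𝓕_v)} ∪ {0} ≅ 𝒪_k = {‖x‖ ≤ 1}` at `v` — t4's parameter `O α v` (constant in the label `α`) — the
valuation ring of the norm. [claim: Mochizuki2012, status: disputed] -/
def integralStructure (v : Vfib) [IsUltrametricDist (K v)] : Subring (K v) :=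
  (NormedField.valuation (K := K v)).integer

omit [∀ v, NormedAlgebra ℚ_[p] (K v)] in
/-- Membership in the integral structure is `‖x‖ ≤ 1`. [claim: Mochizuki2012, status: disputed] -/
theorem mem_integralStructure_iff (v : Vfib) [IsUltrametricDist (K v)] (x : K v) :
    x ∈ integralStructure K v ↔ ‖x‖ ≤ 1 := by
  change NormedField.valuation x ≤ 1 ↔ _
  rw [NormedField.valuation_apply, ← NNReal.coe_le_coe, coe_nnnorm, NNReal.coe_one]

omit [∀ v, NormedAlgebra ℚ_[p] (K v)] in
/-- As a set the integral structure is the closed unit ball `𝒪_k`. [claim: Mochizuki2012, status: disputed] -/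
theorem coe_integralStructure (v : Vfib) [IsUltrametricDist (K v)] :
    (integralStructure K v : Set (K v)) = closedBall (0 : K v) 1 := by
  ext x
  rw [SetLike.mem_coe, mem_integralStructure_iff, mem_closedBall, dist_zero_right]

/-- `p*_v ∈ K_v` (`p` for odd `p`, `p² = 4` for `p = 2`), the scaling factor of the log-shell — the cast of
abc-iut-L6-t3's `pStar p` (Def 1.1 (i) p.24). [claim: Mochizuki2012, status: disputed] -/
abbrev pstarK (v : Vfib) : K v := ((pStar p : ℕ) : K v)

/-- `p*_v ≠ 0` in `K_v`. [claim: Mochizuki2012, status: disputed] -/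
theorem pstarK_ne_zero (v : Vfib) : pstarK p K v ≠ 0 := pStar_cast_ne_zero p (K v)

/-- The log-shell scaling is by a `ℚ_p`-scalar: `(p*)⁻¹ · z = (p*_{ℚ_p})⁻¹ • z` in `K_v`.
[claim: Mochizuki2012, status: disputed] -/
theorem pstarK_inv_mul_eq_smul (v : Vfib) (z : K v) :
    (pstarK p K v)⁻¹ * z = (((pStar p : ℕ) : ℚ_[p])⁻¹) • z := by
  rw [Algebra.smul_def, map_inv₀, map_natCast]

/-- **IUTchIII:Def1.1(i)** (kurims p.24) / Rmk 1.2.2 (i) p.36 at the model: the log-shell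
`I_k := (p_v^*)⁻¹ · log_k(𝒪_k^×) ⊆ k` AS AN ADDITIVE SUBGROUP of `K_v` — t4's parameter `I α v` (constant in
the label `α`) — namely `(p*)⁻¹ •` abc-iut-S1's `log_p(R^×)` (`LogVolume.logUnitsAddSubgroup`).
[claim: Mochizuki2012, status: disputed] -/
def logShellAddSubgroup (v : Vfib) [IsUltrametricDist (K v)] [CompleteSpace (K v)] [ProperSpace (K v)] :
    AddSubgroup (K v) :=
  (pstarK p K v)⁻¹ • LogVolume.logUnitsAddSubgroup p (K v)

/-- **IUTchIII:Prop3.2(i)** (kurims p.98) at the model: the compatibility isomorphism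
`log(^α𝒟^⊢_v) ⥲ log(^α𝓕_v)` — t4's parameter `e α v` — is the identity of `K_v` (Prop 1.2 (vi)–(vii): the
mono-analytic module is "naturally identified" with the underlying module of the holomorphic one).
[claim: Mochizuki2012, status: disputed] -/
abbrev compat (α : A) (v : Vfib) : monoModule A K α v ≃ₗ[ℚ_[p]] holField A K α v := LinearEquiv.refl _ _

/-! ### 2. The log-shell: identification with L4-t3 / L6-t3, inclusions, compactness -/

section OnePlace

variable (v : Vfib) [IsUltrametricDist (K v)] [CompleteSpace (K v)] [ProperSpace (K v)]

/-- AS A SET, t4's `I` at the model is `(p*)⁻¹ • log_p(𝒪^×)`. [claim: Mochizuki2012, status: disputed] -/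
theorem coe_logShellAddSubgroup_eq_smul :
    (logShellAddSubgroup p K v : Set (K v)) = (pstarK p K v)⁻¹ • LogVolume.logUnits (K v) := by
  rw [logShellAddSubgroup, AddSubgroup.coe_pointwise_smul, LogVolume.coe_logUnitsAddSubgroup]

/-- **THE IDENTIFICATION t4 ↔ L4-t3/L6-t3**: as a set, t4's log-shell parameter at the model IS
abc-iut-L4-t3's log-shell `ℐ = (p*)⁻¹ · ℐ*` of the standard model `PadicLogOnUnits.ofUnitLog p K_v`
([AbsTopIII] Def 5.4 (iii); the object abc-iut-L6-t3's `HolomorphicLogShells.lean` is written over).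
[claim: Mochizuki2012, status: disputed] -/
theorem coe_logShellAddSubgroup :
    (logShellAddSubgroup p K v : Set (K v)) = logShell (PadicLogOnUnits.ofUnitLog p (K v)) := by
  rw [coe_logShellAddSubgroup_eq_smul, logShell_ofUnitLog, pstarK, pStar_eq_prime_pow p]

/-- … and it IS abc-iut-L6-t3's `nonarchLogShell O logk p` of `LocalLogShells.lean` (Rmk 1.2.2 (i)) for ANY
presentation of `𝒪_k` as a valuation subring `O` with a logarithm `logk` agreeing with the real one
(`HolomorphicLogShellsProofs.nonarchLogShell_eq_logShell_ofUnitLog`, after abc-iut-L3-t11's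
`nonarchLogShell_eq_image_logUnits`). [claim: Mochizuki2012, status: disputed] -/
theorem coe_logShellAddSubgroup_eq_nonarchLogShell (O : ValuationSubring (K v))
    (hO : ∀ x : K v, x ∈ O ↔ ‖x‖ ≤ 1) (logk : Additive (↥O)ˣ →+ K v)
    (hlog : ∀ u : (↥O)ˣ, logk (Additive.ofMul u) = LogVolume.unitLog ((u : ↥O) : K v)) :
    (logShellAddSubgroup p K v : Set (K v)) = nonarchLogShell O logk p := by
  rw [coe_logShellAddSubgroup, nonarchLogShell_eq_logShell_ofUnitLog p (K v) O hO logk hlog]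

/-- **IUTchIII:Prop1.2(v)** (b^non) (kurims p.33) / Rmk 1.2.2 (i) p.36 "`𝒪_k ⊆ I_k`" at the model: the
integral structure lies in the log-shell (abc-iut-L3-t11 `closedBall_subset_logShell_ofUnitLog`, from
abc-iut-L4-t3's `closedBall_subset_logShell`). [claim: Mochizuki2012, status: disputed] -/
theorem integralStructure_subset_logShell :
    (integralStructure K v : Set (K v)) ⊆ logShellAddSubgroup p K v := by
  rw [coe_integralStructure, coe_logShellAddSubgroup]
  exact closedBall_subset_logShell_ofUnitLog p (K v)

/-- In particular `1 ∈ I_k`. [claim: Mochizuki2012, status: disputed] -/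
theorem one_mem_logShellAddSubgroup : (1 : K v) ∈ logShellAddSubgroup p K v :=
  integralStructure_subset_logShell p K v (Subring.one_mem _)

/-- **IUTchIII:Prop1.2(v)** (a^non) (kurims p.33) "`I_{†𝓕_v}` is compact, hence of finite log-volume" at the
model (`HolomorphicLogShellsProofs.isCompact_logShell_ofUnitLog`, from abc-iut-S1 `isCompact_logUnits`).
[claim: Mochizuki2012, status: disputed] -/
theorem isCompact_logShellAddSubgroup : IsCompact (logShellAddSubgroup p K v : Set (K v)) := by
  rw [coe_logShellAddSubgroup]
  exact isCompact_logShell_ofUnitLog p (K v)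

/-- The log-shell is open (`HolomorphicLogShellsProofs.isOpen_logShell_ofUnitLog`).
[claim: Mochizuki2012, status: disputed] -/
theorem isOpen_logShellAddSubgroup : IsOpen (logShellAddSubgroup p K v : Set (K v)) := by
  rw [coe_logShellAddSubgroup]
  exact isOpen_logShell_ofUnitLog p (K v)

end OnePlace

/-! ### 3. abc-iut-L6-t4's named statements at the model -/

/-- THE EXPORTED FAMILY of integral structures `O : ∀ α v, Subring (L α v)` at the model, in exactly the
binder shape of abc-iut-L6-t4's `TensorPackets.lean` (so that its statements instantiate by application —
MERGE-MAP rows 27/43/53). [claim: Mochizuki2012, status: disputed] -/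
abbrev integralStructureFamily (A : Type) [∀ v, IsUltrametricDist (K v)] :
    ∀ (α : A) (v : Vfib), Subring (holField A K α v) :=
  fun _ v => integralStructure K v

/-- **IUTchIII:Prop3.1(ii)** (kurims p.93), integral-structure clause, HOLDS at the model: t4's
`Prop31ii_integralStructures 𝕜 L O α v` for `L = holField`, `O = integralStructure` (each `log(^α𝓕_v) = K_v`
is a field; abc-iut-L6-t4/t5 `Prop31ii_integralStructures_of_isField`). [claim: Mochizuki2012, status: disputed] -/
theorem prop31ii_integralStructures_model [Fintype A] [DecidableEq A] [Fintype Vfib] [DecidableEq Vfib]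
    [∀ v, IsUltrametricDist (K v)] (α : A) (v : Vfib) :
    Prop31ii_integralStructures ℚ_[p] (holField A K) (integralStructureFamily K A) α v :=
  Prop31ii_integralStructures_of_isField ℚ_[p] (holField A K) (integralStructureFamily K A) α v
    (Field.toIsField (K v))

/-- **IUTchIII:Prop3.1(i)** (kurims p.93), finite level, HOLDS at the model: for `K_v/ℚ_p` finite the
holomorphic tensor packet `⊗_α ⊕_v K_v` is a finite product of fields — t4's instantiation-safe
`Prop31i_ringStructures''` at `L = holField` (abc-iut-L6-t5 `Prop31i_ringStructures''_holds`; separability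
is automatic in characteristic `0`). [claim: Mochizuki2012, status: disputed] -/
theorem prop31i_ringStructures''_model [Fintype A] [Fintype Vfib] [∀ v, FiniteDimensional ℚ_[p] (K v)] :
    Prop31i_ringStructures'' ℚ_[p] (holField A K) :=
  Prop31i_ringStructures''_holds ℚ_[p] (holField A K)

/-! ### 4. Packets of shells (Prop 3.2 (ii)) at the model -/

section Packets

variable [∀ v, IsUltrametricDist (K v)] [∀ v, CompleteSpace (K v)] [∀ v, ProperSpace (K v)]

/-- … and the mono-analytic log-shells `I : ∀ α v, AddSubgroup (D α v)` at the model, in exactly the binder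
shape of abc-iut-L6-t4's `TensorPackets.lean` (its `shellPacket1`, `shellPacketN`, `shellPacketAt`,
`shellPacketN.transport`, `integralStructureDiscrepancyDatum` take this argument — MERGE-MAP rows 27/43/53
close by application). [claim: Mochizuki2012, status: disputed] -/
abbrev logShellFamily (A : Type) : ∀ (α : A) (v : Vfib), AddSubgroup (monoModule A K α v) :=
  fun _ v => logShellAddSubgroup p K v

/-- **IUTchIII:Prop3.2(ii)** (kurims p.98), first display, at the model: an element of the 1-tensor packet
`log(^α𝒟^⊢_{v_ℚ}) = ⊕_v K_v` lies in `𝓘(^α𝒟^⊢_{v_ℚ})` iff every component lies in the local log-shell `I_{K_v}`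
(t4 `mem_shellPacket1_iff`). [claim: Mochizuki2012, status: disputed] -/
theorem mem_shellPacket1_model_iff (α : A) (x : MPacket1 (monoModule A K) α) :
    x ∈ shellPacket1 (monoModule A K) (logShellFamily p K A) α ↔
      ∀ v, x v ∈ logShellAddSubgroup p K v :=
  mem_shellPacket1_iff (monoModule A K) (logShellFamily p K A) α x

/-- As a set, the 1-packet shell is the product `Π_v I_{K_v}`. [claim: Mochizuki2012, status: disputed] -/
theorem coe_shellPacket1_model (α : A) :
    (shellPacket1 (monoModule A K) (logShellFamily p K A) α :
        Set (MPacket1 (monoModule A K) α)) =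
      Set.univ.pi fun v => (logShellAddSubgroup p K v : Set (K v)) := by
  ext x
  rw [SetLike.mem_coe, mem_shellPacket1_model_iff, Set.mem_univ_pi]
  rfl

/-- **IUTchIII:Prop3.2(ii)** / Prop 1.2 (v) (a^non) at the model: the 1-packet shell `⊕_v I_{K_v}` is compact
(finite product of compact shells). [claim: Mochizuki2012, status: disputed] -/
theorem isCompact_shellPacket1_model (α : A) :
    IsCompact (shellPacket1 (monoModule A K) (logShellFamily p K A) α :
      Set (MPacket1 (monoModule A K) α)) := by
  rw [coe_shellPacket1_model]
  exact isCompact_univ_pi fun v => isCompact_logShellAddSubgroup p K v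

/-- … and open (finite product of open shells). [claim: Mochizuki2012, status: disputed] -/
theorem isOpen_shellPacket1_model [Finite Vfib] (α : A) :
    IsOpen (shellPacket1 (monoModule A K) (logShellFamily p K A) α :
      Set (MPacket1 (monoModule A K) α)) := by
  rw [coe_shellPacket1_model]
  exact isOpen_set_pi Set.finite_univ fun v _ => isOpen_logShellAddSubgroup p K v

/-- **IUTchIII:Prop3.2(ii)**, last sentence (kurims p.99) at the model: transporting the `n`-packet shell
`𝓘(^A𝒟^⊢_{v_ℚ})` along the model compatibility isomorphism (the identity) gives the same subgroup of the
holomorphic packet `log(^A𝓕_{v_ℚ})` (t4 `shellPacketN.transport`). [claim: Mochizuki2012, status: disputed] -/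
theorem shellPacketN_transport_model [Fintype A] [DecidableEq A] [Fintype Vfib] [DecidableEq Vfib] :
    shellPacketN.transport ℚ_[p] (monoModule A K) (logShellFamily p K A) (compat p K) =
      shellPacketN ℚ_[p] (holField A K) (logShellFamily p K A) := by
  rw [shellPacketN_transport_eq]
  congr 1
  funext α v
  exact AddSubgroup.ext fun x => by simp

end Packets

/-! ### 5. The direct summands are abc-iut-S1's [IUTchIV] packet algebras -/

/-- **IUTchIII:Rmk3.1.1(ii)** (kurims p.95) ↔ **[IUTchIV] Prop 1.1**: t4's direct summand
`PacketSummand 𝕜 L v⃗ = ⊗_{α∈A} log(^α𝓕_{v_α})` of the decomposition `⊗_α ⊕_v = ⊕_{v⃗} ⊗_α` IS, at the model,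
abc-iut-S1's packet algebra `V = ⊗_{ℚ_p, α} K_{v_α}` (`LogVolume.PacketAlgebra p (fun α => K (v⃗ α))`) —
definitionally. [claim: Mochizuki2012, status: disputed] -/
theorem packetSummand_eq_packetAlgebra [Fintype A] [DecidableEq A] (vA : A → Vfib) :
    PacketSummand ℚ_[p] (holField A K) vA = LogVolume.PacketAlgebra p (fun α => K (vA α)) := rfl

section Summands

variable [Fintype A] [DecidableEq A]
variable [∀ v, IsUltrametricDist (K v)] [∀ v, CompleteSpace (K v)] [∀ v, ProperSpace (K v)]

omit [DecidableEq A] in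
/-- A pure tensor of log-shell elements, read in the summand `v⃗`, is `((p*)⁻¹)^{|A|}` times a pure tensor
of elements of `log_p(𝒪^×)`: the scaling between [IUTchIII]'s `𝓘`-packets and [IUTchIV]'s
`log_p(R_I^×) = ⊗ log_p(R_i^×)` (abc-iut-S1 `LogVolume.logPacket`, generated by the `purePacket`s of
`log_p(𝒪^×)`-elements). [claim: Mochizuki2012, status: disputed] -/
theorem purePacket_shell_mem_smul_logPacket (vA : A → Vfib) (y : ∀ α, K (vA α))
    (hy : ∀ α, y α ∈ logShellAddSubgroup p K (vA α)) :
    LogVolume.purePacket p (fun α => K (vA α)) y ∈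
      ((((pStar p : ℕ) : ℚ_[p])⁻¹) ^ Fintype.card A) •
        (LogVolume.logPacket p (fun α => K (vA α)) : Set (LogVolume.PacketAlgebra p fun α => K (vA α))) := by
  -- write each `y α = (p*)⁻¹ • z α` with `z α ∈ log_p(𝒪^×)`
  have hz : ∀ α, ∃ z : K (vA α), z ∈ LogVolume.logUnits (K (vA α)) ∧
      y α = (((pStar p : ℕ) : ℚ_[p])⁻¹) • z := by
    intro α
    have h := hy α
    rw [← SetLike.mem_coe, coe_logShellAddSubgroup_eq_smul, Set.mem_smul_set] at h
    obtain ⟨z, hz, hzy⟩ := h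
    exact ⟨z, hz, by rw [← hzy, smul_eq_mul, pstarK_inv_mul_eq_smul]⟩
  choose z hzmem hzy using hz
  have hyz : y = fun α => (fun _ : A => (((pStar p : ℕ) : ℚ_[p])⁻¹)) α • z α := funext hzy
  have htprod : LogVolume.purePacket p (fun α => K (vA α)) y =
      ((((pStar p : ℕ) : ℚ_[p])⁻¹) ^ Fintype.card A) • LogVolume.purePacket p (fun α => K (vA α)) z := by
    change tprod ℚ_[p] y = _ • tprod ℚ_[p] z
    rw [hyz, MultilinearMap.map_smul_univ, Finset.prod_const, Finset.card_univ]
  rw [htprod]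
  exact Set.smul_mem_smul_set (AddSubgroup.subset_closure ⟨z, fun α => hzmem α, rfl⟩)

/-- **IUTchIII:Prop3.2(ii)** ↔ **[IUTchIV] Prop 1.2**: for a pure tensor `⊗_α x_α` of the `n`-packet with
every component `x_α(v)` in the local log-shell, the `v⃗`-component of t4's `packetDecomposition`
(`= ⊗_α x_α(v_α)`, `packetDecomposition_tprod`) lies in `((p*)⁻¹)^{|A|} • log_p(R_I^×)` of abc-iut-S1's
packet algebra `⊗_α K_{v_α}`. [claim: Mochizuki2012, status: disputed] -/
theorem packetDecomposition_tprod_shell_mem [Fintype Vfib] [DecidableEq Vfib]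
    (x : ∀ α, MPacket1 (monoModule A K) α) (hx : ∀ α v, x α v ∈ logShellAddSubgroup p K v)
    (vA : A → Vfib) :
    packetDecomposition ℚ_[p] (holField A K) (tprod ℚ_[p] x) vA ∈
      ((((pStar p : ℕ) : ℚ_[p])⁻¹) ^ Fintype.card A) •
        (LogVolume.logPacket p (fun α => K (vA α)) : Set (LogVolume.PacketAlgebra p fun α => K (vA α))) := by
  rw [packetDecomposition_tprod]
  exact purePacket_shell_mem_smul_logPacket p K vA (fun α => x α (vA α)) fun α => hx α (vA α)

end Summands

end LogShellBridge

end Literature.IUT.LogThetaLattice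

end
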